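import Mathlib
import Summits.NavierStokesRegularity.NavierStokesRegularity.Theorems.FrozenSignCascadeTightEnvelopeContinuationRadial
import Literature.Analysis.FluidPDE.NSFourierSobolev
import Literature.Analysis.FluidPDE.NSFourierDictionary
import HarnessLib

/-!
# Route FrozenSignCascade · crux `BoundedEnvelopeContinuation` — stub A: `PM² ⊂ Ṁ^{2,1}`

Helper file for the crux item stmt-NavierStokesRegularity-10579 (`BoundedEnvelopeContinuation`,
conjunct (B) of route `FrozenSignCascade`), line `registered`; lands `--supports` that item and
proves its stub `stub_morreyOfEnvelope` with exactly the registered signature.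

**The harmonic-analysis step.** A pointwise critical Fourier envelope `‖ξ‖² ‖f ξ‖ ≤ C` for a
continuous, polynomially decaying coefficient field `f` on `ℝ³` gives the scale-invariant local
energy bound of the synthesized velocity `u = synthVel f = Re 𝓕 f`:

  `∫_{B_r(x₁)} ‖u‖² ≤ κ C² r`,  `κ = 54 |B₁|³ + 18 |B₁|`  (`|B₁|` = volume of the unit ball),

i.e. the pseudo-measure space `PM²` (Le Jan–Sznitman, Cannone–Karch) embeds in the critical Morrey
space `Ṁ^{2,1}` (Lemarié-Rieusset 2016, §8.5 for the weighted sup-norm calculus). Proof, for each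
component `f_l` and the sharp frequency cutoff at `ρ = 1/r`,
`f_l = 1_{‖ξ‖ ≤ ρ} f_l + 1_{‖ξ‖ > ρ} f_l` (linearity `fourier_add'`):

* low part, pointwise in `x`: `|Re 𝓕(1_{‖ξ‖≤ρ} f_l)(x)| ≤ ∫_{‖ξ‖≤ρ} C ‖ξ‖⁻² dξ ≤ 3|B₁| C ρ`
  (`MorreySharp.integral_ball_inv_norm_sq_le`, polar coordinates; the origin is a null set),
  squared, summed over `l` and integrated over the ball of volume `|B₁| r³`: `54 |B₁|³ C² r`;
* high part, by Plancherel on all of `ℝ³` (`lintegral_sq_fourier_eq`, `(Re z)² ≤ |z|²`):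
  `∫ (Re 𝓕(1_{‖ξ‖>ρ} f_l))² dx ≤ ∫_{‖ξ‖>ρ} C² ‖ξ‖⁻⁴ dξ ≤ 3|B₁| C² ρ⁻¹`
  (`MorreySharp.integral_tail_inv_norm_four_le`), times `2 · 3` components: `18 |B₁| C² r`.

The conjugation symmetry of `f` (reality of `u`) is part of the registered signature but is not
needed by this componentwise argument.

References: P. G. Lemarié-Rieusset, *The Navier–Stokes problem in the 21st century* (2016),
§8.5; M. Cannone, in *Handbook of Mathematical Fluid Dynamics* III (2004), §2.4; folklore.
-/

noncomputable section

set_option linter.dupNamespace false -- nested layout Summit.<S>.<Sub>, Sub = S (D-0017)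

open MeasureTheory Set Metric Real Filter Topology
open scoped FourierTransform RealInnerProductSpace ENNReal
open Literature.Analysis.FluidPDE.FourierNS

namespace Summit.NavierStokesRegularity.NavierStokesRegularity.Theorems.BoundedEnvelope

local notation "E3" => EuclideanSpace ℝ (Fin 3)

namespace MorreySharp

/-! ### Two radial integrals on `ℝ³` -/

/-- **The ball integral of `‖ζ‖⁻²`**: for `0 ≤ ρ`, `∫ 1_{‖ζ‖ ≤ ρ} ‖ζ‖⁻² dζ ≤ 3|B₁| ρ`
(polar coordinates: the radial integrand is `1_{(0,ρ]}`). -/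
theorem integral_ball_inv_norm_sq_le {ρ : ℝ} (hρ : 0 ≤ ρ) :
    ∫ ζ : E3, {ζ : E3 | ‖ζ‖ ≤ ρ}.indicator (fun ζ => (‖ζ‖ ^ 2)⁻¹) ζ ≤
      3 * (volume (ball (0 : E3) 1)).toReal * ρ := by
  set g : ℝ → ℝ := (Iic ρ).indicator fun y => (y ^ 2)⁻¹ with hg
  have hfun : (fun ζ : E3 => {ζ : E3 | ‖ζ‖ ≤ ρ}.indicator (fun ζ => (‖ζ‖ ^ 2)⁻¹) ζ) =
      fun ζ => g ‖ζ‖ := by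
    funext ζ
    simp only [hg, indicator, mem_setOf_eq, mem_Iic]
  rw [hfun, TightEnvelope.integral_fun_norm_three g]
  have hvol : 0 ≤ 3 * (volume (ball (0 : E3) 1)).toReal := by positivity
  refine mul_le_mul_of_nonneg_left ?_ hvol
  have hpt : ∀ y ∈ Ioi (0 : ℝ), y ^ 2 * g y = (Iic ρ).indicator (fun _ => (1 : ℝ)) y := by
    intro y hy
    simp only [hg, indicator, mem_Iic]
    split_ifs with h
    · have hy0 : y ≠ 0 := ne_of_gt hy
      field_simp
    · simp
  rw [setIntegral_congr_fun measurableSet_Ioi hpt, setIntegral_indicator measurableSet_Iic,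
    setIntegral_const, smul_eq_mul, mul_one, Ioi_inter_Iic, measureReal_def, Real.volume_Ioc,
    sub_zero, ENNReal.toReal_ofReal hρ]

/-- The integrand of `integral_ball_inv_norm_sq_le` is integrable (`‖ζ‖⁻²` is locally integrable
on `ℝ³`: the radial integrand `y² · 1_{y ≤ ρ} y⁻² = 1_{(0,ρ]}` is). -/
theorem integrable_ball_inv_norm_sq (ρ : ℝ) :
    Integrable (fun ζ : E3 => {ζ : E3 | ‖ζ‖ ≤ ρ}.indicator (fun ζ => (‖ζ‖ ^ 2)⁻¹) ζ) := by
  set g : ℝ → ℝ := (Iic ρ).indicator fun y => (y ^ 2)⁻¹ with hg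
  have hfun : (fun ζ : E3 => {ζ : E3 | ‖ζ‖ ≤ ρ}.indicator (fun ζ => (‖ζ‖ ^ 2)⁻¹) ζ) =
      fun ζ => g ‖ζ‖ := by
    funext ζ
    simp only [hg, indicator, mem_setOf_eq, mem_Iic]
  rw [hfun, integrable_fun_norm_addHaar volume]
  have h1 : IntegrableOn ((Ioc 0 ρ).indicator fun _ => (1 : ℝ)) (Ioi (0 : ℝ)) :=
    ((integrable_indicator_iff measurableSet_Ioc).2
      (integrableOn_const (hs := measure_Ioc_lt_top.ne))).integrableOn
  refine h1.congr_fun (fun y hy => ?_) measurableSet_Ioi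
  have hy0 : (0 : ℝ) < y := hy
  rw [TightEnvelope.finrank_euclideanSpace_fin_three]
  by_cases h : y ≤ ρ
  · rw [indicator_of_mem (mem_Ioc.2 ⟨hy0, h⟩), hg, indicator_of_mem (mem_Iic.2 h), smul_eq_mul]
    field_simp
  · rw [indicator_of_notMem (fun h' => h h'.2), hg,
      indicator_of_notMem (fun h' => h (mem_Iic.1 h')), smul_zero]

/-- **The tail integral of `‖η‖⁻⁴`**: for `0 < ρ`, `∫ 1_{‖η‖ > ρ} ‖η‖⁻⁴ dη ≤ 3|B₁| ρ⁻¹`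
(polar coordinates and `∫_ρ^∞ y² y⁻⁴ dy = ρ⁻¹`). -/
theorem integral_tail_inv_norm_four_le {ρ : ℝ} (hρ : 0 < ρ) :
    ∫ η : E3, {η : E3 | ‖η‖ ≤ ρ}ᶜ.indicator (fun η => (‖η‖ ^ 4)⁻¹) η ≤
      3 * (volume (ball (0 : E3) 1)).toReal * ρ⁻¹ := by
  set g : ℝ → ℝ := (Ioi ρ).indicator fun y => (y ^ 4)⁻¹ with hg
  have hfun : (fun η : E3 => {η : E3 | ‖η‖ ≤ ρ}ᶜ.indicator (fun η => (‖η‖ ^ 4)⁻¹) η) =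
      fun η => g ‖η‖ := by
    funext η
    simp only [hg, indicator, mem_compl_iff, mem_setOf_eq, mem_Ioi, not_le]
  rw [hfun, TightEnvelope.integral_fun_norm_three g]
  have hvol : 0 ≤ 3 * (volume (ball (0 : E3) 1)).toReal := by positivity
  refine mul_le_mul_of_nonneg_left ?_ hvol
  have hpt : ∀ y ∈ Ioi (0 : ℝ), y ^ 2 * g y = (Ioi ρ).indicator (fun y => y ^ (-2 : ℝ)) y := by
    intro y hy
    simp only [hg, indicator, mem_Ioi]
    split_ifs with h
    · have hy0 : (0 : ℝ) < y := hy
      rw [Real.rpow_neg hy0.le, Real.rpow_two]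
      field_simp
    · simp
  have hset : Ioi (0 : ℝ) ∩ Ioi ρ = Ioi ρ := by
    ext y
    simp only [mem_inter_iff, mem_Ioi]
    exact ⟨fun h => h.2, fun h => ⟨hρ.trans h, h⟩⟩
  have hval : ∫ y in Ioi ρ, y ^ (-2 : ℝ) = ρ⁻¹ := by
    rw [integral_Ioi_rpow_of_lt (by norm_num) hρ]
    have : (-2 : ℝ) + 1 = -1 := by norm_num
    rw [this, Real.rpow_neg_one]
    ring
  rw [setIntegral_congr_fun measurableSet_Ioi hpt, setIntegral_indicator measurableSet_Ioi, hset,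
    hval]

/-- The integrand of `integral_tail_inv_norm_four_le` is integrable (radial integrand
`y² · 1_{y > ρ} y⁻⁴ = 1_{(ρ,∞)} y⁻²`, integrable for `ρ > 0`). -/
theorem integrable_tail_inv_norm_four {ρ : ℝ} (hρ : 0 < ρ) :
    Integrable (fun η : E3 => {η : E3 | ‖η‖ ≤ ρ}ᶜ.indicator (fun η => (‖η‖ ^ 4)⁻¹) η) := by
  set g : ℝ → ℝ := (Ioi ρ).indicator fun y => (y ^ 4)⁻¹ with hg
  have hfun : (fun η : E3 => {η : E3 | ‖η‖ ≤ ρ}ᶜ.indicator (fun η => (‖η‖ ^ 4)⁻¹) η) =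
      fun η => g ‖η‖ := by
    funext η
    simp only [hg, indicator, mem_compl_iff, mem_setOf_eq, mem_Ioi, not_le]
  rw [hfun, integrable_fun_norm_addHaar volume]
  have h1 : IntegrableOn ((Ioi ρ).indicator fun y : ℝ => y ^ (-2 : ℝ)) (Ioi (0 : ℝ)) :=
    ((integrable_indicator_iff measurableSet_Ioi).2
      (integrableOn_Ioi_rpow_of_lt (by norm_num) hρ)).integrableOn
  refine h1.congr_fun (fun y hy => ?_) measurableSet_Ioi
  have hy0 : (0 : ℝ) < y := hy
  rw [TightEnvelope.finrank_euclideanSpace_fin_three]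
  by_cases h : ρ < y
  · rw [indicator_of_mem (mem_Ioi.2 h), hg, indicator_of_mem (mem_Ioi.2 h), smul_eq_mul,
      Real.rpow_neg hy0.le, Real.rpow_two]
    field_simp
  · rw [indicator_of_notMem (fun h' => h (mem_Ioi.1 h')), hg,
      indicator_of_notMem (fun h' => h (mem_Ioi.1 h')), smul_zero]

/-! ### The two frequency pieces of one component -/

/-- **Low frequencies, pointwise**: if `‖g ξ‖ ≤ C ‖ξ‖⁻²` off the origin and `g` is integrable, then
`(Re 𝓕(1_{‖ξ‖ ≤ ρ} g)(x))² ≤ (3|B₁| C ρ)²` for every `x` (`|𝓕 h| ≤ ∫ |h|`). -/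
theorem sq_re_fourier_low_le {g : E3 → ℂ} {C ρ : ℝ} (hC : 0 ≤ C) (hρ : 0 ≤ ρ)
    (hgi : Integrable g) (hg : ∀ ξ, ξ ≠ 0 → ‖g ξ‖ ≤ C * (‖ξ‖ ^ 2)⁻¹) (x : E3) :
    (𝓕 ({ξ : E3 | ‖ξ‖ ≤ ρ}.indicator g) x).re ^ 2 ≤
      (C * (3 * (volume (ball (0 : E3) 1)).toReal * ρ)) ^ 2 := by
  have hSm : MeasurableSet {ξ : E3 | ‖ξ‖ ≤ ρ} :=
    (isClosed_le continuous_norm continuous_const).measurableSet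
  have hint : ∫ ξ, ‖{ξ : E3 | ‖ξ‖ ≤ ρ}.indicator g ξ‖ ≤
      C * (3 * (volume (ball (0 : E3) 1)).toReal * ρ) := by
    calc ∫ ξ, ‖{ξ : E3 | ‖ξ‖ ≤ ρ}.indicator g ξ‖
        ≤ ∫ ξ, C * {ζ : E3 | ‖ζ‖ ≤ ρ}.indicator (fun ζ => (‖ζ‖ ^ 2)⁻¹) ξ := by
          refine integral_mono_ae (hgi.indicator hSm).norm
            ((integrable_ball_inv_norm_sq ρ).const_mul C) ?_
          filter_upwards [Measure.ae_ne volume (0 : E3)] with ξ hξ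
          by_cases hξS : ξ ∈ {ξ : E3 | ‖ξ‖ ≤ ρ}
          · rw [indicator_of_mem hξS, indicator_of_mem hξS]
            exact hg ξ hξ
          · rw [indicator_of_notMem hξS, indicator_of_notMem hξS, norm_zero, mul_zero]
      _ = C * ∫ ξ, {ζ : E3 | ‖ζ‖ ≤ ρ}.indicator (fun ζ => (‖ζ‖ ^ 2)⁻¹) ξ :=
          integral_const_mul _ _
      _ ≤ C * (3 * (volume (ball (0 : E3) 1)).toReal * ρ) :=
          mul_le_mul_of_nonneg_left (integral_ball_inv_norm_sq_le hρ) hC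
  have h1 : |(𝓕 ({ξ : E3 | ‖ξ‖ ≤ ρ}.indicator g) x).re| ≤
      C * (3 * (volume (ball (0 : E3) 1)).toReal * ρ) :=
    calc |(𝓕 ({ξ : E3 | ‖ξ‖ ≤ ρ}.indicator g) x).re|
        ≤ ‖𝓕 ({ξ : E3 | ‖ξ‖ ≤ ρ}.indicator g) x‖ := Complex.abs_re_le_norm _
      _ ≤ ∫ ξ, ‖{ξ : E3 | ‖ξ‖ ≤ ρ}.indicator g ξ‖ :=
          VectorFourier.norm_fourierIntegral_le_integral_norm _ _ _ _ _
      _ ≤ _ := hint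
  calc (𝓕 ({ξ : E3 | ‖ξ‖ ≤ ρ}.indicator g) x).re ^ 2
      = |(𝓕 ({ξ : E3 | ‖ξ‖ ≤ ρ}.indicator g) x).re| ^ 2 := (sq_abs _).symm
    _ ≤ _ := pow_le_pow_left₀ (abs_nonneg _) h1 2

/-- **High frequencies, by Plancherel**: if `g` is continuous with decay of order `4` and
`‖g ξ‖ ≤ C ‖ξ‖⁻²` off the origin, then `∫ (Re 𝓕(1_{‖ξ‖ > ρ} g))² dx ≤ C² · 3|B₁| ρ⁻¹`. -/
theorem lintegral_sq_re_fourier_high_le {g : E3 → ℂ} {C ρ B : ℝ} (hρ : 0 < ρ)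
    (hgc : Continuous g) (hB : HasDecay 4 B g) (hg : ∀ ξ, ξ ≠ 0 → ‖g ξ‖ ≤ C * (‖ξ‖ ^ 2)⁻¹) :
    ∫⁻ x, ENNReal.ofReal ((𝓕 ({ξ : E3 | ‖ξ‖ ≤ ρ}ᶜ.indicator g) x).re ^ 2) ≤
      ENNReal.ofReal (C ^ 2 * (3 * (volume (ball (0 : E3) 1)).toReal * ρ⁻¹)) := by
  have hSm : MeasurableSet {ξ : E3 | ‖ξ‖ ≤ ρ} :=
    (isClosed_le continuous_norm continuous_const).measurableSet
  have h3 : Fintype.card (Fin 3) < 4 := by simp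
  have hdec : HasDecay 4 B ({ξ : E3 | ‖ξ‖ ≤ ρ}ᶜ.indicator g) := fun ξ =>
    (norm_indicator_le_norm_self g ξ).trans (hB ξ)
  have hmeas : AEStronglyMeasurable ({ξ : E3 | ‖ξ‖ ≤ ρ}ᶜ.indicator g) volume :=
    hgc.aestronglyMeasurable.indicator hSm.compl
  have hint : Integrable ({ξ : E3 | ‖ξ‖ ≤ ρ}ᶜ.indicator g) :=
    hdec.integrable (finrank_lt_of_card_lt h3) hmeas
  have hI := integrable_tail_inv_norm_four hρ
  calc ∫⁻ x, ENNReal.ofReal ((𝓕 ({ξ : E3 | ‖ξ‖ ≤ ρ}ᶜ.indicator g) x).re ^ 2)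
      ≤ ∫⁻ x, ‖𝓕 ({ξ : E3 | ‖ξ‖ ≤ ρ}ᶜ.indicator g) x‖ₑ ^ 2 :=
        lintegral_mono fun x => ofReal_re_sq_le _
    _ = ∫⁻ ξ, ‖{ξ : E3 | ‖ξ‖ ≤ ρ}ᶜ.indicator g ξ‖ₑ ^ 2 :=
        lintegral_sq_fourier_eq hint (memLp_two_of_hasDecay h3 hdec hmeas)
    _ ≤ ∫⁻ ξ, ENNReal.ofReal
          (C ^ 2 * {η : E3 | ‖η‖ ≤ ρ}ᶜ.indicator (fun η => (‖η‖ ^ 4)⁻¹) ξ) := by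
        refine lintegral_mono fun ξ => ?_
        rw [← ofReal_norm, ← ENNReal.ofReal_pow (norm_nonneg _)]
        refine ENNReal.ofReal_le_ofReal ?_
        by_cases hξS : ξ ∈ {ξ : E3 | ‖ξ‖ ≤ ρ}ᶜ
        · rw [indicator_of_mem hξS, indicator_of_mem hξS]
          simp only [mem_compl_iff, mem_setOf_eq, not_le] at hξS
          have hξ0 : ξ ≠ 0 := by
            intro h
            rw [h, norm_zero] at hξS
            exact lt_irrefl _ (hρ.trans hξS)
          calc ‖g ξ‖ ^ 2 ≤ (C * (‖ξ‖ ^ 2)⁻¹) ^ 2 := pow_le_pow_left₀ (norm_nonneg _) (hg ξ hξ0) 2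
            _ = C ^ 2 * (‖ξ‖ ^ 4)⁻¹ := by ring
        · rw [indicator_of_notMem hξS, indicator_of_notMem hξS]
          simp
    _ = ENNReal.ofReal
          (∫ ξ, C ^ 2 * {η : E3 | ‖η‖ ≤ ρ}ᶜ.indicator (fun η => (‖η‖ ^ 4)⁻¹) ξ) := by
        rw [← ofReal_integral_eq_lintegral_ofReal (hI.const_mul _)
          (Eventually.of_forall fun ξ =>
            mul_nonneg (sq_nonneg _) (indicator_nonneg (fun η _ => by positivity) _))]
    _ ≤ _ := by
        refine ENNReal.ofReal_le_ofReal ?_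
        rw [integral_const_mul]
        exact mul_le_mul_of_nonneg_left (integral_tail_inv_norm_four_le hρ) (sq_nonneg _)

/-- The high-frequency synthesis `x ↦ Re 𝓕(1_{‖ξ‖ > ρ} g)(x)` is continuous (Fourier transform
of an integrable function). -/
theorem continuous_re_fourier_high {g : E3 → ℂ} (ρ : ℝ) {B : ℝ} (hgc : Continuous g)
    (hB : HasDecay 4 B g) :
    Continuous fun x : E3 => (𝓕 ({ξ : E3 | ‖ξ‖ ≤ ρ}ᶜ.indicator g) x).re := by
  have hSm : MeasurableSet {ξ : E3 | ‖ξ‖ ≤ ρ} :=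
    (isClosed_le continuous_norm continuous_const).measurableSet
  have h3 : Fintype.card (Fin 3) < 4 := by simp
  have hdec : HasDecay 4 B ({ξ : E3 | ‖ξ‖ ≤ ρ}ᶜ.indicator g) := fun ξ =>
    (norm_indicator_le_norm_self g ξ).trans (hB ξ)
  have hint : Integrable ({ξ : E3 | ‖ξ‖ ≤ ρ}ᶜ.indicator g) :=
    hdec.integrable (finrank_lt_of_card_lt h3) (hgc.aestronglyMeasurable.indicator hSm.compl)
  exact Complex.continuous_re.comp
    (VectorFourier.fourierIntegral_continuous Real.continuous_fourierChar
      (by exact continuous_inner) hint)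

end MorreySharp

/-! ### The stub -/

/-- **stub A — `stub_morreyOfEnvelope` (`PM² ⊂ Ṁ^{2,1}`).** There is a universal `κ ≥ 0`
(`κ = 54 |B₁|³ + 18 |B₁|`) such that for every continuous, polynomially decaying,
conjugation-symmetric coefficient field `f` on `ℝ³` with critical envelope `‖ξ‖² ‖f ξ‖ ≤ C` the
synthesized velocity has scale-invariant local energy `∫_{B_r(x₁)} ‖synthVel f‖² ≤ κ C² r`
(sharp frequency cutoff at `1/r`: low part pointwise, high part by Plancherel). -/
theorem stub_morreyOfEnvelope :
    ∃ κ : ℝ, 0 ≤ κ ∧ ∀ (C : ℝ) (f : EuclideanSpace ℝ (Fin 3) → Fin 3 → ℂ), 0 ≤ C → Continuous f →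
      (∀ K : ℕ, ∃ B : ℝ, Literature.Analysis.FluidPDE.FourierNS.HasDecay K B f) →
      (∀ (ξ : EuclideanSpace ℝ (Fin 3)) (l : Fin 3), f (-ξ) l = (starRingEnd ℂ) (f ξ l)) →
      (∀ ξ : EuclideanSpace ℝ (Fin 3), ‖ξ‖ ^ 2 * ‖f ξ‖ ≤ C) →
      ∀ (x₁ : EuclideanSpace ℝ (Fin 3)) (r : ℝ), 0 < r →
        ∫ x in Metric.ball x₁ r, ‖Literature.Analysis.FluidPDE.FourierNS.synthVel f x‖ ^ 2 ≤
          κ * C ^ 2 * r := by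
  have hVB0 : 0 ≤ (volume (ball (0 : E3) 1)).toReal := ENNReal.toReal_nonneg
  refine ⟨54 * (volume (ball (0 : E3) 1)).toReal ^ 3 + 18 * (volume (ball (0 : E3) 1)).toReal,
    by positivity, ?_⟩
  intro C f hC hf hdec _ henv x₁ r hr
  set VB : ℝ := (volume (ball (0 : E3) 1)).toReal with hVB
  have hr0 : r ≠ 0 := hr.ne'
  have hρ : 0 < r⁻¹ := inv_pos.2 hr
  obtain ⟨B, hB⟩ := hdec 4
  have h3 : Fintype.card (Fin 3) < 4 := by simp
  have hSm : MeasurableSet {ξ : E3 | ‖ξ‖ ≤ r⁻¹} :=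
    (isClosed_le continuous_norm continuous_const).measurableSet
  -- the envelope off the origin, componentwise
  have henv' : ∀ (l : Fin 3) (ξ : E3), ξ ≠ 0 → ‖f ξ l‖ ≤ C * (‖ξ‖ ^ 2)⁻¹ := by
    intro l ξ hξ
    have hξ2 : 0 < ‖ξ‖ ^ 2 := pow_pos (norm_pos_iff.2 hξ) 2
    calc ‖f ξ l‖ ≤ ‖f ξ‖ := norm_le_pi_norm (f ξ) l
      _ ≤ C * (‖ξ‖ ^ 2)⁻¹ := by
          rw [← div_eq_mul_inv, le_div_iff₀ hξ2, mul_comm]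
          exact henv ξ
  -- the components and their two frequency pieces
  have hFc : ∀ l : Fin 3, Continuous fun ξ : E3 => f ξ l := fun l => (continuous_apply l).comp hf
  have hFd : ∀ l : Fin 3, HasDecay 4 B (fun ξ : E3 => f ξ l) := fun l => hB.apply l
  have hFi : ∀ l : Fin 3, Integrable (fun ξ : E3 => f ξ l) := fun l =>
    (hFd l).integrable (finrank_lt_of_card_lt h3) (hFc l).aestronglyMeasurable
  have hloi : ∀ l : Fin 3, Integrable ({ξ : E3 | ‖ξ‖ ≤ r⁻¹}.indicator fun ξ : E3 => f ξ l) :=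
    fun l => (hFi l).indicator hSm
  have hhii : ∀ l : Fin 3, Integrable ({ξ : E3 | ‖ξ‖ ≤ r⁻¹}ᶜ.indicator fun ξ : E3 => f ξ l) :=
    fun l => (hFi l).indicator hSm.compl
  have hsplit : ∀ (l : Fin 3) (x : E3), synthVel f x l =
      (𝓕 ({ξ : E3 | ‖ξ‖ ≤ r⁻¹}.indicator fun ξ : E3 => f ξ l) x).re +
        (𝓕 ({ξ : E3 | ‖ξ‖ ≤ r⁻¹}ᶜ.indicator fun ξ : E3 => f ξ l) x).re := by
    intro l x
    rw [synthVel_apply, ← Complex.add_re, ← fourier_add' (hloi l) (hhii l),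
      indicator_self_add_compl]
  -- the two bounds
  set L : ℝ := C * (3 * VB * r⁻¹) with hL
  have hlow : ∀ (l : Fin 3) (x : E3),
      (𝓕 ({ξ : E3 | ‖ξ‖ ≤ r⁻¹}.indicator fun ξ : E3 => f ξ l) x).re ^ 2 ≤ L ^ 2 :=
    fun l x => MorreySharp.sq_re_fourier_low_le hC hρ.le (hFi l) (henv' l) x
  have hhigh : ∀ l : Fin 3,
      ∫⁻ x, ENNReal.ofReal ((𝓕 ({ξ : E3 | ‖ξ‖ ≤ r⁻¹}ᶜ.indicator fun ξ : E3 => f ξ l) x).re ^ 2) ≤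
        ENNReal.ofReal (C ^ 2 * (3 * VB * r⁻¹⁻¹)) :=
    fun l => MorreySharp.lintegral_sq_re_fourier_high_le hρ (hFc l) (hFd l) (henv' l)
  have hbm : ∀ l : Fin 3, Measurable fun x : E3 =>
      ENNReal.ofReal ((𝓕 ({ξ : E3 | ‖ξ‖ ≤ r⁻¹}ᶜ.indicator fun ξ : E3 => f ξ l) x).re ^ 2) :=
    fun l => ((MorreySharp.continuous_re_fourier_high r⁻¹ (hFc l) (hFd l)).pow 2).measurable
      |>.ennreal_ofReal
  -- pointwise bound of the integrand
  have hpt : ∀ x : E3, ENNReal.ofReal (‖synthVel f x‖ ^ 2) ≤ ENNReal.ofReal (6 * L ^ 2) +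
      2 * ∑ l : Fin 3, ENNReal.ofReal
        ((𝓕 ({ξ : E3 | ‖ξ‖ ≤ r⁻¹}ᶜ.indicator fun ξ : E3 => f ξ l) x).re ^ 2) := by
    intro x
    have h2 : ∀ l : Fin 3, synthVel f x l ^ 2 ≤ 2 * L ^ 2 +
        2 * (𝓕 ({ξ : E3 | ‖ξ‖ ≤ r⁻¹}ᶜ.indicator fun ξ : E3 => f ξ l) x).re ^ 2 := by
      intro l
      rw [hsplit l x]
      nlinarith [hlow l x,
        sq_nonneg ((𝓕 ({ξ : E3 | ‖ξ‖ ≤ r⁻¹}.indicator fun ξ : E3 => f ξ l) x).re -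
          (𝓕 ({ξ : E3 | ‖ξ‖ ≤ r⁻¹}ᶜ.indicator fun ξ : E3 => f ξ l) x).re)]
    calc ENNReal.ofReal (‖synthVel f x‖ ^ 2)
        ≤ ENNReal.ofReal (6 * L ^ 2 + 2 * ∑ l : Fin 3,
            (𝓕 ({ξ : E3 | ‖ξ‖ ≤ r⁻¹}ᶜ.indicator fun ξ : E3 => f ξ l) x).re ^ 2) := by
          refine ENNReal.ofReal_le_ofReal ?_
          rw [EuclideanSpace.real_norm_sq_eq]
          calc ∑ l, synthVel f x l ^ 2
              ≤ ∑ l : Fin 3, (2 * L ^ 2 +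
                  2 * (𝓕 ({ξ : E3 | ‖ξ‖ ≤ r⁻¹}ᶜ.indicator fun ξ : E3 => f ξ l) x).re ^ 2) :=
                Finset.sum_le_sum fun l _ => h2 l
            _ = _ := by
                rw [Finset.sum_add_distrib, Finset.sum_const, Finset.card_univ, Fintype.card_fin,
                  nsmul_eq_mul, Nat.cast_ofNat, ← Finset.mul_sum]
                ring
      _ = _ := by
          rw [ENNReal.ofReal_add (by positivity) (by positivity), ENNReal.ofReal_mul zero_le_two,
            ENNReal.ofReal_ofNat, ENNReal.ofReal_sum_of_nonneg fun l _ => sq_nonneg _]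
  -- integration over the ball
  have hmeas_sv : AEStronglyMeasurable (fun x : E3 => ‖synthVel f x‖ ^ 2)
      (volume.restrict (ball x₁ r)) :=
    ((contDiff_synthVel f hf hdec).continuous.norm.pow 2).aestronglyMeasurable
  have hvol : volume (ball x₁ r) = ENNReal.ofReal (r ^ 3) * ENNReal.ofReal VB := by
    rw [Measure.addHaar_ball_of_pos volume x₁ hr, TightEnvelope.finrank_euclideanSpace_fin_three,
      hVB, ENNReal.ofReal_toReal measure_ball_lt_top.ne]
  have hprod : ENNReal.ofReal (6 * L ^ 2) * volume (ball x₁ r) =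
      ENNReal.ofReal (6 * L ^ 2 * (r ^ 3 * VB)) := by
    rw [hvol, ← ENNReal.ofReal_mul (by positivity : (0 : ℝ) ≤ r ^ 3),
      ← ENNReal.ofReal_mul (by positivity : (0 : ℝ) ≤ 6 * L ^ 2)]
  have hsum : (2 : ℝ≥0∞) * ∑ _l : Fin 3, ENNReal.ofReal (C ^ 2 * (3 * VB * r⁻¹⁻¹)) =
      ENNReal.ofReal (6 * (C ^ 2 * (3 * VB * r⁻¹⁻¹))) := by
    rw [Finset.sum_const, Finset.card_univ, Fintype.card_fin, nsmul_eq_mul, Nat.cast_ofNat,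
      ENNReal.ofReal_mul (by norm_num : (0 : ℝ) ≤ 6), ENNReal.ofReal_ofNat]
    ring
  have hmain : ∫⁻ x in ball x₁ r, ENNReal.ofReal (‖synthVel f x‖ ^ 2) ≤
      ENNReal.ofReal (6 * L ^ 2 * (r ^ 3 * VB) + 6 * (C ^ 2 * (3 * VB * r⁻¹⁻¹))) := by
    calc ∫⁻ x in ball x₁ r, ENNReal.ofReal (‖synthVel f x‖ ^ 2)
        ≤ ∫⁻ x in ball x₁ r, (ENNReal.ofReal (6 * L ^ 2) + 2 * ∑ l : Fin 3, ENNReal.ofReal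
            ((𝓕 ({ξ : E3 | ‖ξ‖ ≤ r⁻¹}ᶜ.indicator fun ξ : E3 => f ξ l) x).re ^ 2)) :=
          lintegral_mono fun x => hpt x
      _ = ENNReal.ofReal (6 * L ^ 2) * volume (ball x₁ r) +
            2 * ∑ l : Fin 3, ∫⁻ x in ball x₁ r, ENNReal.ofReal
              ((𝓕 ({ξ : E3 | ‖ξ‖ ≤ r⁻¹}ᶜ.indicator fun ξ : E3 => f ξ l) x).re ^ 2) := by
          rw [lintegral_add_left measurable_const, lintegral_const, Measure.restrict_apply_univ,
            lintegral_const_mul _ (Finset.measurable_fun_sum _ fun l _ => hbm l),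
            lintegral_finsetSum _ fun l _ => hbm l]
      _ ≤ ENNReal.ofReal (6 * L ^ 2) * volume (ball x₁ r) +
            2 * ∑ _l : Fin 3, ENNReal.ofReal (C ^ 2 * (3 * VB * r⁻¹⁻¹)) := by
          gcongr
          exact (setLIntegral_le_lintegral _ _).trans (hhigh _)
      _ = _ := by
          rw [hprod, hsum, ← ENNReal.ofReal_add (by positivity) (by positivity)]
  rw [integral_eq_lintegral_of_nonneg_ae (Eventually.of_forall fun x => sq_nonneg _) hmeas_sv]
  refine ENNReal.toReal_le_of_le_ofReal (by positivity) (hmain.trans_eq ?_)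
  rw [inv_inv, hL]
  congr 1
  field_simp
  ring

end Summit.NavierStokesRegularity.NavierStokesRegularity.Theorems.BoundedEnvelope

end
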